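import Literature.MathematicalPhysics.QuantumFieldTheory.Balaban1983to89.MatrixLog
import Literature.MathematicalPhysics.QuantumFieldTheory.Balaban1983to89.B8

/-!
# `Balaban1983to89.B11Eq160BondField` — T. Bałaban, *The variational problem and background fields in renormalization group method for lattice gauge theories*, Commun. Math. Phys. **102** (1985) 277–309 [Balaban1985Variational]: (160) p. 303 — the bound `|B(x, x′)| < (8d²L² + 4L²|x − y|)ε₁` on the field `B` of the local datum `V₁ = e^{iB}`, PROVED as the printed two-case derivation (the generalized-axial-gauge estimate, Lemma 1 of [6] in its typed form `B8.Lemma1Printed`, and the logarithm bound `|(1/i) log V| ≦ 2|V − 1|`) (theorem-only module)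

statement-level skeleton of published theorems with citation tags; proofs where landed; nothing here is a claim about the Yang–Mills mass gap

PDF held: `paper:balaban1985-cmp102-variational-background` (journal page = PDF page + 276).  Render
`run/shared/lean/pub/pub-balaban/b2b-balaban-ref1/pages/1985-cmp102-variational-background/…-p027-x2.png` (p. 303) READ
AS IMAGE by this seat (lit-balaban reader/typer r08, gen 4, 2026-08-21).

CITATION HEADER (lean-in-tree rule 2026-08-18).  WHAT IS REPRODUCED: SKELETON row `B11.Eq159` = displays (159)–(161)
p. 303, its member (160) — so far «typed by reference» only (the (161) ⇒ ¼B₃ bookkeeping of the same row is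
`B11B3.ineq161_le_quarter_B3`).  Sibling modules used BY NAME: `MatrixLog` (`mlog` = the logarithm of [4] (21) with
`norm_mlog_le_two_mul`, `exp_mlog`; the same device proves (172) in `B11Eq172LogBound`), `B8` (`B8.Lemma1Printed` =
Lemma 1 (1.24)–(1.25) of [6], row `B8.Lem1`, typed).

THE PRINT (p. 303 [PDF 27], verbatim from the render).  «Let us consider the configuration HB on the cube □. Now we use
the assumption (7) for V, hence for V′. It implies that |V′₁(∂p) − 1| < ε₁ for p ∈ □̃″_k^{(k)}, and |V′₁(∂p) − 1| < 2L²ε₁ for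
p ⊂ □̃′_k^{(k)} and ε₁ small, where the configuration V′₁ was defined by (147). It satisfies the generalized axial gauge
conditions on □̃_k^{(k)} with a center at the point y, hence |V′₁(x, x′) − 1| < |x − y|2L²ε₁ for ⟨x, x′⟩ ⊂ □̃_k^{(k)}. If
⟨x, x′⟩ ∈ □̃″_k^{(k)}, then V′₁(x, x′) = V′(x, x′) = V″(x, x′) = V₁(x, x′), the last equality follows from the definition of
V₁ in (154) and from the assumption that V″ = V′ on □̃′_k^{(k−1)} and V′ ∈ Ax₁(□̃_k^{(k)}, 1), hence V″(Γ_{x,x₁}) = 1 for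
x₁ ∈ B(x), x ∈ □̃″_k^{(k)}. Thus the above estimate implies that |B(x, x′)| < |x − y|4L²ε₁. If ⟨x, x′⟩ ⊂ □̃′_k^{(k)}, then we
apply the Lemma 1 of [6]. We consider the set Λ′ = B(x) ∪ B(x′), and the assumptions of this lemma are satisfied for
V′ = V″ = V₁ with α₀ = L²ε₁, α₁ = |x − y|2L²ε₁. The lemma implies that |V₁(x₁, x′₁) − 1| < 4d²L²ε₁ + |x − y|2L²ε₁ for
⟨x₁, x′₁⟩ ⊂ B(x) ∪ B(x′), hence |B(x₁, x′₁)| < 8d²L²ε₁ + |x − y|4L²ε₁. Finally we have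
  |B(x, x′)| < (8d²L² + 4L²|x − y|)ε₁ for ⟨x, x′⟩ ∈ □̃′_k^{(k−1)} ∪ □̃″_k^{(k)}. (160)»
(V₁ = e^{iB} is (155) p. 302.)

DICTIONARY (abstract; nothing re-declared).  `V₁ : 𝔄` = the bond variable `V₁(x, x′)` (or `V₁(x₁, x′₁)`) in a complete
normed ℂ-algebra; `B = (1/i) log V₁ = (−i)·mlog V₁` (`MatrixLog.mlog`, as in `B11Eq172LogBound`); `dxy : ℝ` = the
distance `|x − y|` to the centre `y`; `L ε₁ : ℝ`; `d : ℕ`.  Lemma 1 of [6] enters BY NAME as the hypothesis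
`hL : B8.Lemma1Printed d fam` (row `B8.Lem1`, a typed statement of another paper — not a fact of this file), its data
`V₀ : (fam i).Cfg`, `V′ : (fam i).Pert` with `(fam i).small α₀ V₀ V′` («V₀, V′V₀ satisfy (1.7) … (R(V₀)V′)(Γ_{y,x}) = 1»),
`(fam i).axialClose α₁ V₀ V′` («|V′V₀‾ − V̄₀| < α₁»), `(fam i).pertDev V′` = the sup of `|V′ − 1|` over the bonds of `Ω₁`;
the printed instantiation is `α₀ = L²ε₁`, `α₁ = |x − y|2L²ε₁`.  The print's «ε₁ small» is the explicit smallness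
`‖V₁ − 1‖ ≦ ½`-type hypothesis under which `|log V| ≦ 2|V − 1|` (`MatrixLog.norm_mlog_le_two_mul`).

WHAT IS CERTIFIED (kernel, sorry-free; axioms `propext` / `Classical.choice` / `Quot.sound`).
§1 `exp_fieldB`, `norm_fieldB_le` — «V₁ = e^{iB}» with `B = (1/i) log V₁` and `|B| ≦ 2|V₁ − 1|` for `|V₁ − 1| ≦ ½`.
§2 CASE ⟨x, x′⟩ ∈ □̃″ `ineq160_caseI`: `|V₁ − 1| < |x − y|2L²ε₁` (and `|x − y|2L²ε₁ ≦ ½`) ⇒ `|B| < |x − y|4L²ε₁`.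
§3 CASE ⟨x, x′⟩ ⊂ □̃′ `ineq160_caseII_of_lemma1`: from `B8.Lemma1Printed` with `α₀ = L²ε₁`, `α₁ = |x − y|2L²ε₁` (both
`≦ c`, the constant of the lemma) and a bond value `V₁` with `|V₁ − 1| ≦ pertDev V′`, `|V₁ − 1| ≦ ½`:
`|B| < 8d²L²ε₁ + |x − y|4L²ε₁` (the printed «hence»); the arithmetic `2·(4d²L²ε₁ + |x−y|2L²ε₁) = 8d²L²ε₁ + |x−y|4L²ε₁` is
`two_mul_lemma1_bound`.
§4 **(160)** `ineq160_of_caseI` / `ineq160_of_caseII` / `ineq160`: either case bound is `< (8d²L² + 4L²|x − y|)ε₁`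
(case I needs only `0 ≦ ε₁`).

HONEST SCOPE — what is NOT claimed.  (i) The lattice objects (□̃′, □̃″, the generalized axial gauge, (147), (154)) are
not constructed: the two case hypotheses are exactly the two printed estimates «|V′₁(x, x′) − 1| < |x − y|2L²ε₁» and the
Lemma 1 conclusion; which case a bond is in is the consumer's datum.  (ii) Lemma 1 of [6] is USED in its typed form
`B8.Lemma1Printed` (hypothesis), exactly as the print uses it; it is not proved here (row `B8.Lem1`).  (iii) `B` is THE
logarithm `(1/i) log V₁` of [4] (21) (principal branch near 1); the print's «V₁ = e^{iB}» with a small `B` determines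
`B` uniquely only for `|B|` small, which is the regime of (155)/(160).  (iv) No constant is renamed or optimised;
«ε₁ small» is the explicit `≦ ½` smallness.  Unit `lit-balaban-r08` gen 4 (`HOME/lit-balaban-r08/ROWS-B11.md` row
B11.Eq159).
-/

namespace Literature.MathematicalPhysics.QuantumFieldTheory.Balaban1983to89.B11Eq160BondField

open NormedSpace
open Literature.MathematicalPhysics.QuantumFieldTheory.Balaban1983to89.MatrixLog

variable {𝔄 : Type*} [NormedRing 𝔄] [NormedAlgebra ℂ 𝔄] [CompleteSpace 𝔄]

/-! ## §1 «V₁ = e^{iB}»: the field `B = (1/i) log V₁` and its size -/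

/-- «V₁ = e^{iB}» (155)/(160) p. 302–303 with `B = (1/i) log V₁ = (−i)·log V₁`: `exp (iB) = V₁` whenever `|V₁ − 1| < 1`.
[cite: Balaban1985Variational, (160) p.303] -/
theorem exp_fieldB {V₁ : 𝔄} (hV : ‖V₁ - 1‖ < 1) :
    exp (Complex.I • ((-Complex.I) • mlog V₁)) = V₁ := by
  rw [smul_smul]
  simp [exp_mlog hV]

/-- The logarithm bound behind both «hence» of (160) p. 303: `|B| = |(1/i) log V₁| ≦ 2|V₁ − 1|` for `|V₁ − 1| ≦ ½`
(`MatrixLog.norm_mlog_le_two_mul`). [cite: Balaban1985Variational, (160) p.303] -/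
theorem norm_fieldB_le {V₁ : 𝔄} (hV : ‖V₁ - 1‖ ≤ 1 / 2) :
    ‖(-Complex.I) • mlog V₁‖ ≤ 2 * ‖V₁ - 1‖ := by
  rw [norm_smul, norm_neg, Complex.norm_I, one_mul]
  exact norm_mlog_le_two_mul hV

/-! ## §2 Case ⟨x, x′⟩ ∈ □̃″_k^{(k)}: the generalized-axial-gauge estimate -/

/-- **(160), first case** p. 303: «|V′₁(x, x′) − 1| < |x − y|2L²ε₁ … V′₁(x, x′) = … = V₁(x, x′) … Thus the above
estimate implies that |B(x, x′)| < |x − y|4L²ε₁» — for `|x − y|2L²ε₁ ≦ ½` («ε₁ small»).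
[cite: Balaban1985Variational, (160) p.303] -/
theorem ineq160_caseI {V₁ : 𝔄} {dxy L ε₁ : ℝ}
    (hV : ‖V₁ - 1‖ < dxy * (2 * L ^ 2 * ε₁)) (hsmall : dxy * (2 * L ^ 2 * ε₁) ≤ 1 / 2) :
    ‖(-Complex.I) • mlog V₁‖ < dxy * (4 * L ^ 2 * ε₁) := by
  have h2 : ‖V₁ - 1‖ ≤ 1 / 2 := le_trans hV.le hsmall
  calc ‖(-Complex.I) • mlog V₁‖ ≤ 2 * ‖V₁ - 1‖ := norm_fieldB_le h2
    _ < 2 * (dxy * (2 * L ^ 2 * ε₁)) := by linarith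
    _ = dxy * (4 * L ^ 2 * ε₁) := by ring

/-! ## §3 Case ⟨x, x′⟩ ⊂ □̃′_k^{(k)}: Lemma 1 of [6] -/

/-- The arithmetic of the second «hence» of (160): `2·(4d²·(L²ε₁) + |x − y|2L²ε₁) = 8d²L²ε₁ + |x − y|4L²ε₁`.
[cite: Balaban1985Variational, (160) p.303] -/
theorem two_mul_lemma1_bound (d : ℕ) (dxy L ε₁ : ℝ) :
    2 * (4 * (d : ℝ) ^ 2 * (L ^ 2 * ε₁) + dxy * (2 * L ^ 2 * ε₁))
      = 8 * (d : ℝ) ^ 2 * L ^ 2 * ε₁ + dxy * (4 * L ^ 2 * ε₁) := by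
  ring

/-- **(160), second case** p. 303: «If ⟨x, x′⟩ ⊂ □̃′_k^{(k)}, then we apply the Lemma 1 of [6]. We consider the set
Λ′ = B(x) ∪ B(x′), and the assumptions of this lemma are satisfied for V′ = V″ = V₁ with α₀ = L²ε₁, α₁ = |x − y|2L²ε₁.
The lemma implies that |V₁(x₁, x′₁) − 1| < 4d²L²ε₁ + |x − y|2L²ε₁ for ⟨x₁, x′₁⟩ ⊂ B(x) ∪ B(x′), hence |B(x₁, x′₁)| <
8d²L²ε₁ + |x − y|4L²ε₁.»  Lemma 1 of [6] enters in its typed form `B8.Lemma1Printed` (row `B8.Lem1`): `c` is its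
constant, `α₀ = L²ε₁`, `α₁ = |x − y|2L²ε₁` are «small» (`≦ c`), `V₁` is a bond value of the configuration `V′` of the
lemma on `Ω₁ ⊃ B(x) ∪ B(x′)` (`|V₁ − 1| ≦ pertDev V′`), and `|V₁ − 1| ≦ ½` is the logarithm smallness.
[cite: Balaban1985Variational, (160) p.303] -/
theorem ineq160_caseII_of_lemma1 {I : Type} {d : ℕ} {fam : I → B8.LocalData} (hL : B8.Lemma1Printed d fam) :
    ∃ c : ℝ, 0 < c ∧ ∀ i : I, ∀ dxy L ε₁ : ℝ,
      0 < L ^ 2 * ε₁ → L ^ 2 * ε₁ ≤ c → 0 < dxy * (2 * L ^ 2 * ε₁) → dxy * (2 * L ^ 2 * ε₁) ≤ c →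
      ∀ V₀ : (fam i).Cfg, ∀ V' : (fam i).Pert,
        (fam i).small (L ^ 2 * ε₁) V₀ V' → (fam i).axialClose (dxy * (2 * L ^ 2 * ε₁)) V₀ V' →
        ∀ V₁ : 𝔄, ‖V₁ - 1‖ ≤ (fam i).pertDev V' → ‖V₁ - 1‖ ≤ 1 / 2 →
          ‖(-Complex.I) • mlog V₁‖ < 8 * (d : ℝ) ^ 2 * L ^ 2 * ε₁ + dxy * (4 * L ^ 2 * ε₁) := by
  obtain ⟨c, hc, hmain⟩ := hL
  refine ⟨c, hc, ?_⟩
  intro i dxy L ε₁ hα₀ hα₀c hα₁ hα₁c V₀ V' hsmall hax V₁ hV₁ hhalf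
  -- Lemma 1 of [6]: |V′ − 1| < 4d²α₀ + α₁ on Ω₁, with α₀ = L²ε₁, α₁ = |x − y|2L²ε₁
  have hlem : (fam i).pertDev V' < 4 * (d : ℝ) ^ 2 * (L ^ 2 * ε₁) + dxy * (2 * L ^ 2 * ε₁) :=
    hmain i (L ^ 2 * ε₁) (dxy * (2 * L ^ 2 * ε₁)) hα₀ hα₀c hα₁ hα₁c V₀ V' hsmall hax
  -- the bond value: |V₁(x₁, x′₁) − 1| < 4d²L²ε₁ + |x − y|2L²ε₁
  have hV : ‖V₁ - 1‖ < 4 * (d : ℝ) ^ 2 * (L ^ 2 * ε₁) + dxy * (2 * L ^ 2 * ε₁) := lt_of_le_of_lt hV₁ hlem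
  -- hence |B(x₁, x′₁)| ≦ 2|V₁ − 1| < 8d²L²ε₁ + |x − y|4L²ε₁
  calc ‖(-Complex.I) • mlog V₁‖ ≤ 2 * ‖V₁ - 1‖ := norm_fieldB_le hhalf
    _ < 2 * (4 * (d : ℝ) ^ 2 * (L ^ 2 * ε₁) + dxy * (2 * L ^ 2 * ε₁)) := by linarith
    _ = 8 * (d : ℝ) ^ 2 * L ^ 2 * ε₁ + dxy * (4 * L ^ 2 * ε₁) := two_mul_lemma1_bound d dxy L ε₁

/-! ## §4 (160): «Finally we have |B(x, x′)| < (8d²L² + 4L²|x − y|)ε₁» -/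

omit [NormedAlgebra ℂ 𝔄] [CompleteSpace 𝔄] in
/-- **(160)** from the first case: `|B| < |x − y|4L²ε₁ ≦ (8d²L² + 4L²|x − y|)ε₁` (for `0 ≦ ε₁`).
[cite: Balaban1985Variational, (160) p.303] -/
theorem ineq160_of_caseI {B : 𝔄} {d : ℕ} {dxy L ε₁ : ℝ} (hε : 0 ≤ ε₁)
    (hB : ‖B‖ < dxy * (4 * L ^ 2 * ε₁)) :
    ‖B‖ < (8 * (d : ℝ) ^ 2 * L ^ 2 + 4 * L ^ 2 * dxy) * ε₁ := by
  have h8 : 0 ≤ 8 * (d : ℝ) ^ 2 * L ^ 2 * ε₁ := by positivity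
  calc ‖B‖ < dxy * (4 * L ^ 2 * ε₁) := hB
    _ ≤ 8 * (d : ℝ) ^ 2 * L ^ 2 * ε₁ + dxy * (4 * L ^ 2 * ε₁) := le_add_of_nonneg_left h8
    _ = (8 * (d : ℝ) ^ 2 * L ^ 2 + 4 * L ^ 2 * dxy) * ε₁ := by ring

omit [NormedAlgebra ℂ 𝔄] [CompleteSpace 𝔄] in
/-- **(160)** from the second case: `|B| < 8d²L²ε₁ + |x − y|4L²ε₁ = (8d²L² + 4L²|x − y|)ε₁`.
[cite: Balaban1985Variational, (160) p.303] -/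
theorem ineq160_of_caseII {B : 𝔄} {d : ℕ} {dxy L ε₁ : ℝ}
    (hB : ‖B‖ < 8 * (d : ℝ) ^ 2 * L ^ 2 * ε₁ + dxy * (4 * L ^ 2 * ε₁)) :
    ‖B‖ < (8 * (d : ℝ) ^ 2 * L ^ 2 + 4 * L ^ 2 * dxy) * ε₁ := by
  calc ‖B‖ < 8 * (d : ℝ) ^ 2 * L ^ 2 * ε₁ + dxy * (4 * L ^ 2 * ε₁) := hB
    _ = (8 * (d : ℝ) ^ 2 * L ^ 2 + 4 * L ^ 2 * dxy) * ε₁ := by ring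

/-- **(160)** p. 303 assembled: a bond ⟨x, x′⟩ of `□̃′_k^{(k−1)} ∪ □̃″_k^{(k)}` is in one of the two printed cases, and in
either case `|B(x, x′)| < (8d²L² + 4L²|x − y|)ε₁`.  Case I = the generalized-axial-gauge estimate on `V₁ = V′₁` (with
its smallness), case II = the bound delivered by Lemma 1 of [6] (`ineq160_caseII_of_lemma1`).
[cite: Balaban1985Variational, (160) p.303] -/
theorem ineq160 {V₁ : 𝔄} {d : ℕ} {dxy L ε₁ : ℝ} (hε : 0 ≤ ε₁)
    (hcase : (‖V₁ - 1‖ < dxy * (2 * L ^ 2 * ε₁) ∧ dxy * (2 * L ^ 2 * ε₁) ≤ 1 / 2)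
      ∨ ‖(-Complex.I) • mlog V₁‖ < 8 * (d : ℝ) ^ 2 * L ^ 2 * ε₁ + dxy * (4 * L ^ 2 * ε₁)) :
    ‖(-Complex.I) • mlog V₁‖ < (8 * (d : ℝ) ^ 2 * L ^ 2 + 4 * L ^ 2 * dxy) * ε₁ := by
  rcases hcase with ⟨hV, hsmall⟩ | hB
  · exact ineq160_of_caseI hε (ineq160_caseI hV hsmall)
  · exact ineq160_of_caseII hB

end Literature.MathematicalPhysics.QuantumFieldTheory.Balaban1983to89.B11Eq160BondField
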